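import Summits.BirchSwinnertonDyer.Rank1Residual.Additive.CongruentPartnerMainConjectureGordEPW
import Summits.BirchSwinnertonDyer.Rank1Residual.Additive.GordRamifiedOrdinaryLinePair
import HarnessLib

/-!
# "X4 ROUTE G", FILE 4 SEQUEL (TB-ROL FILE D): K-C′ from the EPW transfer with the per-pair LINE DATA
# DISCHARGED — the two ramified ordinary lines and the line-respecting clause are THEOREMS
# (`GordRamifiedOrdinaryLine`, `GordRamifiedOrdinaryLinePair`), so the EPW inputs of a congruent pair of
# X4♯(G-ord) ∩ `I₀*` rows reduce to `TorsionIso W W₁ p` and `Σ₀` (team n1011, seat p10 gen 3, row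
# TB-ROL; lead GEN 6 R5-32; p07-g3 GEN 3 "sequel dropping the per-pair line binders once TB-ROL lands")

HONEST FRAMING (cell `b2b-bsdres`, run/shared/lean/b2b/bsd-rank1-residual/, verbatim in every
file): the goal of the cell is to DELETE the COMBINATION-SHAPED residual classes of the
Birch–Swinnerton-Dyer formula for ALL analytic-rank `≤ 1` elliptic curves over `ℚ` — "full BSD
formula for every rank `≤ 1` curve in class `C`" assembled STRICTLY from published theorems — so
that the rank-`≤ 1` remainder becomes exactly the CONSTRUCTION-SHAPED classes, which are TYPED
(missing-input `Prop`s), NOT attempted. This is not "finishing BSD". Team n1011 (N10/N11: X4 ∧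
`p = 3`): research route on the CONSTRUCTION-SHAPED class X4; prove what is provable now; no claim
beyond stated classes; census output = EVIDENCE / conjecture items, never a Literature fact;
X4♯(G-ord) stays CONSTRUCTION-SHAPED; RESIDUAL-MAP marks UNCHANGED; nothing is booked by this file.
Theorems only: NO definition, NO new named fact, NO conjecture node. Named facts enter as
HYPOTHESES exactly as in FILE 4: `hK` (Kato 2004 Thm. 17.4 (3), half-eigenspace reading) and `hEPW`
(`EmertonPollackWeston2006.muLambdaAlg_transfer_of_torsionIso_potOrd`). NO hypothesis of FILE 4 is
silently dropped: the binders `hL`, `hL₁`, `hiso` of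
`ClassX4Gord.mainConjecture_of_katoHalf_of_coeffCert_of_epw` are SUPPLIED by the theorem
`ClassX4Gord.exists_epwLineData_of_torsionIso` from `TorsionIso W W₁ p` and the partner's class
binders `ClassX4Gord W₁ p`, `e_{E₁}(p) = 2` (the partner is a row of the same class — which is what a
congruent partner on the same EPW branch is); the place `v ∋ p` is no longer a parameter (it exists).

## What

* `ClassX4Gord.mainConjecture_of_katoHalf_of_coeffCert_of_epw_of_torsionIso` — FILE 4 §2 with
  (`hL`, `hL₁`, `hiso`, `v`) replaced by (`ClassX4Gord W₁ p`, `semistabilityIndex W₁ p = 2`,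
  `TorsionIso W W₁ p`): on X4♯(G-ord) ∩ `I₀*` ∩ {`ρ̄_{E,p}` onto} with a congruent X4♯(G-ord) ∩ `I₀*`
  partner, Kato half + EPW + ONE unit coefficient at `E` at index `b = r₁ + Σ_{w∈Σ₀}(δ(E₁,w) − δ(E,w))`
  + `r₁ ≤ λ(X(E₁))` at the partner ⟹ the branch main conjecture at `E` (`μ = 0`, `λ = b`) and
  `μ(X(E₁)) = 0`, `λ(X(E₁)) = r₁`.
* `…_of_torsionIso_of_partnerZero` — the case `r₁ = 0`.
Remaining per-pair inputs (evidence / certificate tier): `TorsionIso W W₁ p` (GV Thm. (1.4)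
hypothesis; Kraus–Oesterlé / Sturm), `Σ₀`, the unit coefficient (ENGINE value, two-engine rule), the
partner's `λ`-lower bound. READING OF RECORD (referee 1 ACK-1 proviso P1) unchanged: EPW Thm. 3.3.3 in
its `ω^i`-form on the Hida family of `ρ̄_{E♭}` at `i = (p−1)/2`; `e = B(E,p) − B(E₁,p)`, `b = B(E,p)`.

References: Emerton–Pollack–Weston, Invent. Math. 163 (2006) Thms. 3.3.2, 3.3.3, Lemma 5.1.5, p. 3
[EmertonPollackWeston2006]; Kato, Astérisque 295 (2004) Thm. 17.4 (3) [Kato2004Asterisque];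
Greenberg–Vatsal, Invent. Math. 142 (2000) Thm. (1.4), §2 p. 26 [GreenbergVatsal2000].
-/

set_option autoImplicit false

noncomputable section

open scoped Classical MatrixGroups ModularForm NumberField

open CongruenceSubgroup WeierstrassCurve NumberField Field Literature.NumberTheory.EllipticCurves
  Literature.NumberTheory.EllipticCurves.ModularForms
  Literature.NumberTheory.EllipticCurves.Rank1Residual
  Literature.NumberTheory.EllipticCurves.Rank1Residual.Typed
  Literature.NumberTheory.GaloisRepresentations
  Literature.NumberTheory.EllipticCurves.GreenbergSelmer
  Literature.NumberTheory.EllipticCurves.Wuthrich2014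
  Literature.NumberTheory.EllipticCurves.GreenbergVatsal2000
  Literature.NumberTheory.EllipticCurves.EmertonPollackWeston2006
  Summit.BirchSwinnertonDyer.Rank1Residual.AdditivePotMult
  Summit.BirchSwinnertonDyer.Rank1Residual.X1.MuLambda
  Summit.BirchSwinnertonDyer.Rank1Residual.X11a
  Summit.BirchSwinnertonDyer.Rank1Residual.Iwasawa
  IsDedekindDomain

open Summit.BirchSwinnertonDyer.Rank1Residual.X1.CongruenceTransfer (TorsionIso CongruentLambdaShift)

namespace Summit.BirchSwinnertonDyer.Rank1Residual.Additive

variable {W : WeierstrassCurve ℚ} [W.IsElliptic] [W.IsGloballyMinimal] {p : ℕ} [hp : Fact p.Prime]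

/-- **K-C′ from the EPW transfer, line data DISCHARGED.** X4♯(G-ord) ∩ `I₀*` ∩ {`ρ̄_{E,p}` onto},
every odd `p`; a globally minimal CONGRUENT partner `W₁` in X4♯(G-ord) ∩ `I₀*` (`TorsionIso W W₁ p`:
`E[p] ≅ E₁[p]` as `Γ_ℚ`-modules); the cited facts `hK`, `hEPW`; a finite set of places `Σ₀ ∌ p`
outside which both curves are good; at the partner a torsion dual datum with `r₁ ≤ λ(X(E₁))`; at `E`
ONE unit coefficient at index `b = r₁ + Σ_{w ∈ Σ₀} (δ(E₁,w) − δ(E,w))`. THEN the branch main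
conjecture at `E` (`char_Λ X = (g)`, `ι g = C(u·ϖ)·B`, `μ(X(E)) = 0`, `λ(X(E)) = b`) and at the partner
`μ(X(E₁)) = 0`, `λ(X(E₁)) = r₁`. The ramified ordinary lines of both curves and the line-respecting
`E[p] ≃ E₁[p]` demanded by EPW are theorems (`ClassX4Gord.exists_epwLineData_of_torsionIso`, at the
place `v_p`). READING OF RECORD (referee 1 proviso P1): EPW Thm. 3.3.3 in `ω^i`-form on the Hida family
of `ρ̄_{E♭}` at `i = (p−1)/2`; `e = B(E,p) − B(E₁,p)`, `b = B(E,p)`.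
[cite: EmertonPollackWeston2006, Thm. 3.3.2, Thm. 3.3.3 (2) (arXiv:math/0404484 p. 19), Lemma 5.1.5 (p. 30), p. 3]
[cite: Kato2004Asterisque, Thm. 17.4 (3) (p. 273)] [cite: GreenbergVatsal2000, Thm. (1.4) and §2 p. 26] -/
theorem ClassX4Gord.mainConjecture_of_katoHalf_of_coeffCert_of_epw_of_torsionIso
    (hK : Wuthrich2014.kato_halfEigenCharIdeal_dvd_cyclotomicPrime_of_surjective)
    (hEPW : muLambdaAlg_transfer_of_torsionIso_potOrd)
    (hX : ClassX4Gord W p) (he : semistabilityIndex W p = 2) (hsurj : Surj W p)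
    {W₁ : WeierstrassCurve ℚ} [W₁.IsElliptic] [W₁.IsGloballyMinimal]
    (hX₁ : ClassX4Gord W₁ p) (he₁ : semistabilityIndex W₁ p = 2) (hT : TorsionIso W W₁ p)
    (S₀ : Finset (HeightOneSpectrum (𝓞 ℚ))) (hS₀ : ∀ w ∈ S₀, ((p : ℕ) : 𝓞 ℚ) ∉ w.asIdeal)
    (hS : ∀ w : HeightOneSpectrum (𝓞 ℚ), w ∉ S₀ → ((p : ℕ) : 𝓞 ℚ) ∉ w.asIdeal →
      W.HasGoodReductionAt w)
    (hS₁ : ∀ w : HeightOneSpectrum (𝓞 ℚ), w ∉ S₀ → ((p : ℕ) : 𝓞 ℚ) ∉ w.asIdeal →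
      W₁.HasGoodReductionAt w)
    {r₁ b : ℕ} (hb : (b : ℤ) = r₁ + ∑ w ∈ S₀, ((delta W₁ p w : ℤ) - (delta W p w : ℤ)))
    (hcert : BranchUnitCoeffAt W p b)
    (V : WeierstrassCurve ℚ) [V.IsElliptic] [V.IsGloballyMinimal] (C : VariableChange ℚ)
    (hC : C • V.quadraticTwist ((-1 : ℚ) ^ (p / 2) * p) = W) (hV : GoodOrd V p)
    {κ : ZpExtension ℚ p} {γ : Field.absoluteGaloisGroup ℚ} {N : ℕ} [NeZero N]
    {f : CuspForm (Gamma0 N) 2}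
    (hκ : κ.IsCyclotomic) (hγ : κ.IsTopGenerator γ) (hcv : IsCyclotomicVariable p γ)
    (hf : IsNewformOf V f) (D : W.SelmerDualData κ γ) (D₁ : W₁.SelmerDualData κ γ)
    (hX₁t : D₁.IsTorsion) (hr₁ : r₁ ≤ lambdaInvariant p D₁.X) (ϖ : ℚ)
    (hϖ : if Even (p / 2) then (ϖ : ℝ) * V.realPeriodRat = plusPeriod f
      else (ϖ : ℝ) * V.imaginaryPeriodRat = minusPeriod f) :
    (D.IsTorsion ∧ ∃ (g : IwasawaAlgebra p) (u : ℤ_[p]ˣ), D.charIdeal = Ideal.span {g} ∧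
      iwasawaToPowerSeries p g =
        PowerSeries.C (((u : ℤ_[p]) : ℚ_[p]) * (ϖ : ℚ_[p])) *
          (if Even (p / 2) then padicLFunctionBranch f ((unitRoot V p : ℤ_[p]) : ℚ_[p]) (p / 2)
            else padicLFunctionMinusBranch f ((unitRoot V p : ℤ_[p]) : ℚ_[p]) (p / 2)) ∧
      D.mu = 0 ∧ lambdaInvariant p D.X = b) ∧ D₁.mu = 0 ∧ lambdaInvariant p D₁.X = r₁ := by
  -- the place `v_p` of `ℚ` above `p`
  obtain ⟨v, hv⟩ : ∃ v : HeightOneSpectrum (𝓞 ℚ), ((p : ℕ) : 𝓞 ℚ) ∈ v.asIdeal :=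
    ⟨(Rat.HeightOneSpectrum.primesEquiv (R := 𝓞 ℚ)).symm ⟨p, hp.out⟩,
      (natCast_mem_asIdeal_iff_eq_primesEquiv_symm _ hp.out).mpr rfl⟩
  -- the EPW line data of the pair (TB-ROL FILES B/C)
  obtain ⟨L, L₁, hL, hL₁, hiso⟩ := hX.exists_epwLineData_of_torsionIso he hX₁ he₁ hT hv
  exact hX.mainConjecture_of_katoHalf_of_coeffCert_of_epw hK hEPW he hsurj hv hL hL₁ hiso S₀ hS₀ hS hS₁
    hb hcert V C hC hV hκ hγ hcv hf D D₁ hX₁t hr₁ ϖ hϖ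

/-- **K-C′ from the EPW transfer, line data discharged, partner with no λ-input (`r₁ = 0`).** As the
previous theorem with the trivial lower bound at the partner: the unit coefficient at `E` sits at index
`b = Σ_{w ∈ Σ₀} (δ(E₁,w) − δ(E,w))`; conclusion MC on the branch at `E` with `μ = 0`, `λ(X(E)) = b`, and
`μ(X(E₁)) = 0`, `λ(X(E₁)) = 0`. READING OF RECORD (referee 1 proviso P1) as above.
[cite: EmertonPollackWeston2006, Thm. 3.3.2, Thm. 3.3.3 (2) (arXiv:math/0404484 p. 19)]
[cite: Kato2004Asterisque, Thm. 17.4 (3) (p. 273)] [cite: GreenbergVatsal2000, Thm. (1.4)] -/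
theorem ClassX4Gord.mainConjecture_of_katoHalf_of_coeffCert_of_epw_of_torsionIso_of_partnerZero
    (hK : Wuthrich2014.kato_halfEigenCharIdeal_dvd_cyclotomicPrime_of_surjective)
    (hEPW : muLambdaAlg_transfer_of_torsionIso_potOrd)
    (hX : ClassX4Gord W p) (he : semistabilityIndex W p = 2) (hsurj : Surj W p)
    {W₁ : WeierstrassCurve ℚ} [W₁.IsElliptic] [W₁.IsGloballyMinimal]
    (hX₁ : ClassX4Gord W₁ p) (he₁ : semistabilityIndex W₁ p = 2) (hT : TorsionIso W W₁ p)
    (S₀ : Finset (HeightOneSpectrum (𝓞 ℚ))) (hS₀ : ∀ w ∈ S₀, ((p : ℕ) : 𝓞 ℚ) ∉ w.asIdeal)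
    (hS : ∀ w : HeightOneSpectrum (𝓞 ℚ), w ∉ S₀ → ((p : ℕ) : 𝓞 ℚ) ∉ w.asIdeal →
      W.HasGoodReductionAt w)
    (hS₁ : ∀ w : HeightOneSpectrum (𝓞 ℚ), w ∉ S₀ → ((p : ℕ) : 𝓞 ℚ) ∉ w.asIdeal →
      W₁.HasGoodReductionAt w)
    {b : ℕ} (hb : (b : ℤ) = ∑ w ∈ S₀, ((delta W₁ p w : ℤ) - (delta W p w : ℤ)))
    (hcert : BranchUnitCoeffAt W p b)
    (V : WeierstrassCurve ℚ) [V.IsElliptic] [V.IsGloballyMinimal] (C : VariableChange ℚ)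
    (hC : C • V.quadraticTwist ((-1 : ℚ) ^ (p / 2) * p) = W) (hV : GoodOrd V p)
    {κ : ZpExtension ℚ p} {γ : Field.absoluteGaloisGroup ℚ} {N : ℕ} [NeZero N]
    {f : CuspForm (Gamma0 N) 2}
    (hκ : κ.IsCyclotomic) (hγ : κ.IsTopGenerator γ) (hcv : IsCyclotomicVariable p γ)
    (hf : IsNewformOf V f) (D : W.SelmerDualData κ γ) (D₁ : W₁.SelmerDualData κ γ)
    (hX₁t : D₁.IsTorsion) (ϖ : ℚ)
    (hϖ : if Even (p / 2) then (ϖ : ℝ) * V.realPeriodRat = plusPeriod f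
      else (ϖ : ℝ) * V.imaginaryPeriodRat = minusPeriod f) :
    (D.IsTorsion ∧ ∃ (g : IwasawaAlgebra p) (u : ℤ_[p]ˣ), D.charIdeal = Ideal.span {g} ∧
      iwasawaToPowerSeries p g =
        PowerSeries.C (((u : ℤ_[p]) : ℚ_[p]) * (ϖ : ℚ_[p])) *
          (if Even (p / 2) then padicLFunctionBranch f ((unitRoot V p : ℤ_[p]) : ℚ_[p]) (p / 2)
            else padicLFunctionMinusBranch f ((unitRoot V p : ℤ_[p]) : ℚ_[p]) (p / 2)) ∧
      D.mu = 0 ∧ lambdaInvariant p D.X = b) ∧ D₁.mu = 0 ∧ lambdaInvariant p D₁.X = 0 :=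
  hX.mainConjecture_of_katoHalf_of_coeffCert_of_epw_of_torsionIso hK hEPW he hsurj hX₁ he₁ hT S₀ hS₀
    hS hS₁ (r₁ := 0) (by rw [hb]; push_cast; ring) hcert V C hC hV hκ hγ hcv hf D D₁ hX₁t
    (Nat.zero_le _) ϖ hϖ

end Summit.BirchSwinnertonDyer.Rank1Residual.Additive

end
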